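import Literature.Analysis.FunctionSpaces.BesselKExpMellin
import Mathlib.Analysis.SpecialFunctions.Gamma.Deligne
import Mathlib.Analysis.SpecialFunctions.Gaussian.GaussianIntegral
import HarnessLib

/-!
# The Mellin transform of `K_ν`: `∫₀^∞ y^{s-1} K_ν(y) dy = 2^{s-2} Γ((s+ν)/2) Γ((s-ν)/2)`,
# and the archimedean `GL(2)` factor `∫₀^∞ K_ν(2πy) y^{s-1} dy = ¼ Γ_ℝ(s+ν) Γ_ℝ(s-ν)`

Sibling proof file of `BesselK.lean` / `BesselKMellin.lean` / `BesselKExpMellin.lean` (theorems only: no definition, no named fact).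
The classical Mellin transform of the Macdonald function (Watson, *Bessel Functions*, §13.21 (8);
DLMF 10.43.19; "the well-known transform
`∫₀^∞ K_{ν-1/2}(y) y^{s+1/2} dy/y = 2^{-3/2+s} Γ((1+s-ν)/2) Γ((s+ν)/2)`" of Goldfeld (2006), proof of
Prop. 3.13.5, PDF p. 74 of the held copy):

  `∫₀^∞ y^{s-1} K_ν(y) dy = 2^{s-2} Γ((s+ν)/2) Γ((s-ν)/2)`   for `Re s > |Re ν|`

(`integral_cpow_mul_besselK`), together with the absolute convergence of the integral
(`integrableOn_cpow_mul_besselK`), the scaled form `∫₀^∞ y^{s-1} K_ν(cy) dy = c^{-s} 2^{s-2} Γ Γ`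
(`integral_cpow_mul_besselK_mul`, `c > 0`) and the normalisation in which it enters the Hecke theory
of `GL(2)` over `ℝ` — the Mellin transform along the torus `diag(y, 1)` of the weight-zero Whittaker
function `W(diag(y,1)) = √y K_ν(2πy)` is the archimedean Euler factor of the even principal series,
`∫₀^∞ K_ν(2πy) y^{s-1} dy = ¼ π^{-s} Γ((s+ν)/2) Γ((s-ν)/2) = ¼ Γ_ℝ(s+ν) Γ_ℝ(s-ν)`
(`integral_besselK_two_pi_mul_cpow`, Mathlib's `Complex.Gammaℝ`; Goldfeld (2006), (3.13.6);
Bump (1997), §1.9; Jacquet–Langlands (1970), Thm. 5.15 with the table of `L(s, π)` for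
`π = π(μ₁, μ₂)`, `F = ℝ`). Everything is PROVED:

1. (§1) **the `cosh`-moment of `(cosh t)^{-s}`**: `∫₀^∞ cosh(νt) ((cosh t)⁻¹)^s dt = 2^{s-2} B((s+ν)/2, (s-ν)/2)`
   for `Re s > |Re ν|` (`integral_cosh_mul_inv_cosh_cpow`), from the tree's
   `integral_cosh_mul_one_div_one_add_cosh_cpow` (`∫₀^∞ cosh(νt)(1/(1+cosh t))^μ dt = 2^{μ-1} B(μ+ν, μ-ν)`,
   `BesselKExpMellin`) at `(μ, ν) = (s/2, ν/2)` by the substitution `t ↦ 2t` and `1 + cosh 2t = 2 cosh² t`;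
2. (§2) **the kernel** `G(y, t) = y^{s-1} e^{-y cosh t} cosh(νt)` on `(0,∞)²`: integrability for
   `Re s > |Re ν|` (`integrable_mellinKBesselKernel`: with `a = Re s`, `b = |Re ν|`, `a' = (a+b)/2`,
   `e^{-y cosh t} ≤ e^{-y/2} · C (y cosh t / 2)^{-a'}` gives the product majorant
   `C 4^{a'} · (y^{a-a'-1} e^{-y/2}) · e^{-(a'-b)t}`), and the inner Gamma integral
   `∫₀^∞ G(y, t) dy = cosh(νt) Γ(s) ((cosh t)⁻¹)^s` (`integral_mellinKBesselKernel_left`, Mathlib's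
   `Complex.integral_cpow_mul_exp_neg_mul_Ioi`);
3. (§3) **the theorem** (`integral_cpow_mul_besselK`): insert `K_ν(y) = ∫₀^∞ e^{-y cosh t} cosh(νt) dt`
   (`besselK`), Fubini on `(0,∞)²`, §2, §1 and `Γ(u)Γ(v) = Γ(u+v) B(u, v)` with `u + v = s`;
   integrability of `y ↦ y^{s-1} K_ν(y)` on `(0, ∞)` (`integrableOn_cpow_mul_besselK`);
4. (§4) **scalings**: `∫₀^∞ y^{s-1} K_ν(cy) dy = c^{-s} 2^{s-2} Γ((s+ν)/2)Γ((s-ν)/2)` for `c > 0`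
   (`integral_cpow_mul_besselK_mul`), integrability (`integrableOn_cpow_mul_besselK_mul`), and the
   `GL(2)` normalisation `∫₀^∞ K_ν(2πy) y^{s-1} dy = ¼ Γ_ℝ(s+ν) Γ_ℝ(s-ν)` (`integral_besselK_two_pi_mul_cpow`).

What is NOT here: the Mellin transforms of the general Whittaker functions `W_{κ,μ}` (`κ ≠ 0`), the
two-sided transforms over `ℝˣ` with a sign character and the complex-place (`Γ_ℂ`) versions; these
are recorded where the corresponding Kirillov functions are.

## References
* [Watson1944] G. N. Watson, *A Treatise on the Theory of Bessel Functions*, 2nd ed., CUP 1944,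
  §13.21 (8) (the Mellin transform of `K_ν`).
* [DLMF] NIST Digital Library of Mathematical Functions, 10.43.19.
* [Goldfeld2006] D. Goldfeld, *Automorphic Forms and L-Functions for the Group GL(n,ℝ)*, CUP 2006,
  Prop. 3.13.5 and its proof, (3.13.6) (PDF p. 74 of the held copy
  `book:goldfeldnd-automorphic-forms-l-functions-group-gl-n`).
* [Bump1997] D. Bump, *Automorphic Forms and Representations*, CUP 1997, §1.9.
* [JacquetLanglands1970] H. Jacquet, R. P. Langlands, *Automorphic Forms on GL(2)*, LNM 114 (1970),
  Thm. 5.15 (PDF p. 129 of the held retypeset copy).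

Mathlib: `Complex.betaIntegral`, `Complex.Gamma_mul_Gamma_eq_betaIntegral`, `Complex.Gammaℝ`,
`Complex.integral_cpow_mul_exp_neg_mul_Ioi`, `integrableOn_rpow_mul_exp_neg_mul_rpow`,
`exp_neg_integrableOn_Ioi`, `MeasureTheory.integral_comp_mul_left_Ioi`,
`MeasureTheory.integrableOn_Ioi_comp_mul_left_iff`, `MeasureTheory.integral_integral_swap`,
`MeasureTheory.Integrable.integral_prod_left`, `Integrable.mul_prod`, `Measure.prod_restrict`,
`Complex.mul_cpow_ofReal_nonneg`, `Complex.cpow_nat_mul'`, `Complex.inv_cpow`,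
`Complex.norm_cpow_eq_rpow_re_of_pos`, `Real.cosh_two_mul`, `Real.cosh_sq`.
Literature: `besselK`, `besselKIntegrand`, `besselK_def` (`BesselK.lean`);
`integral_cosh_mul_one_div_one_add_cosh_cpow`, `norm_cosh_le_cosh_re`, `exp_neg_le_mul_rpow_neg`,
`cosh_rpow_neg_le` (`BesselKExpMellin.lean`); `DeBruijn1950.cosh_le_exp_abs`. Tree search
(`lean search 'integral.*besselK|besselK.*Gamma|mellin.*besselK'`): only
`integral_cpow_mul_exp_neg_mul_besselK` (the transform of `e^{-y} K_ν(y)`) and the Laplace-type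
`∫₀^∞ u^{ν-1} e^{-x(u/c+c/u)/2} du = 2 c^ν K_ν(x)` are in the tree.
-/

noncomputable section

namespace Literature.Analysis.FunctionSpaces

open MeasureTheory Set Real _root_.Complex Filter
open scoped Topology

/-! ## 1. The `cosh`-moment of `(cosh t)^{-s}` -/

section CoshMoment

/-- `1/(1 + cosh 2u) = ½ · ((cosh u)⁻¹)²` (`1 + cosh 2u = 2 cosh² u`). [folklore] -/
theorem one_div_one_add_cosh_two_mul (u : ℝ) :
    1 / (1 + Real.cosh (2 * u)) = (1 / 2 : ℝ) * ((Real.cosh u)⁻¹) ^ 2 := by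
  have hc : Real.cosh u ≠ 0 := (Real.cosh_pos u).ne'
  have h2 : 1 + Real.cosh (2 * u) = 2 * Real.cosh u ^ 2 := by
    rw [Real.cosh_two_mul]
    nlinarith [Real.cosh_sq u]
  rw [h2]
  field_simp

/-- For `c > 0`: `((½ (c⁻¹)²) : ℂ) ^ z = 2^{-z} · (c⁻¹)^{2z}` (real positive bases). [folklore] -/
theorem half_mul_inv_sq_cpow {c : ℝ} (hc : 0 < c) (z : ℂ) :
    (((1 / 2 : ℝ) * (c⁻¹) ^ 2 : ℝ) : ℂ) ^ z = (2 : ℂ) ^ (-z) * ((c⁻¹ : ℝ) : ℂ) ^ (2 * z) := by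
  have h1 : (0 : ℝ) ≤ 1 / 2 := by norm_num
  have h2 : (0 : ℝ) ≤ (c⁻¹) ^ 2 := sq_nonneg _
  have hcast : (((1 / 2 : ℝ) * (c⁻¹) ^ 2 : ℝ) : ℂ) = ((1 / 2 : ℝ) : ℂ) * (((c⁻¹) ^ 2 : ℝ) : ℂ) := by
    push_cast; ring
  rw [hcast, mul_cpow_ofReal_nonneg h1 h2]
  congr 1
  · have e : ((1 / 2 : ℝ) : ℂ) = ((2 : ℝ) : ℂ)⁻¹ := by push_cast; ring
    rw [e, inv_cpow _ _ (by rw [arg_ofReal_of_nonneg zero_le_two]; exact Real.pi_pos.ne),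
      cpow_neg]
    norm_num
  · have e : (((c⁻¹) ^ 2 : ℝ) : ℂ) = ((c⁻¹ : ℝ) : ℂ) ^ (2 : ℕ) := by push_cast; ring
    have harg : ((c⁻¹ : ℝ) : ℂ).arg = 0 := arg_ofReal_of_nonneg (inv_nonneg.mpr hc.le)
    rw [e, ← cpow_nat_mul' (by rw [harg]; simp [Real.pi_pos]) (by rw [harg]; simp [Real.pi_pos.le])]
    norm_num

variable {s ν : ℂ}

/-- **The `cosh`-moment of `(cosh t)^{-s}`**: for `Re s > |Re ν|`,
`∫₀^∞ cosh(νt) ((cosh t)⁻¹)^s dt = 2^{s-2} B((s+ν)/2, (s-ν)/2)`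
(`= 2^{s-2} Γ((s+ν)/2)Γ((s-ν)/2)/Γ(s)`; the substitution `t ↦ 2t` in the `cosh`-moment of
`(1 + cosh t)^{-s/2}`). [folklore] -/
theorem integral_cosh_mul_inv_cosh_cpow (h : |ν.re| < s.re) :
    ∫ t in Ioi (0 : ℝ), Complex.cosh (ν * t) * (((Real.cosh t)⁻¹ : ℝ) : ℂ) ^ s =
      (2 : ℂ) ^ (s - 2) * Complex.betaIntegral ((s + ν) / 2) ((s - ν) / 2) := by
  -- the tree's moment at `(μ, ν) = (s/2, ν/2)`
  have h' : |(ν / 2).re| < (s / 2).re := by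
    rw [div_ofNat_re, div_ofNat_re, abs_div, abs_of_pos (by norm_num : (0 : ℝ) < 2)]
    linarith
  have hmom := integral_cosh_mul_one_div_one_add_cosh_cpow h'
  rw [show s / 2 + ν / 2 = (s + ν) / 2 by ring, show s / 2 - ν / 2 = (s - ν) / 2 by ring] at hmom
  -- substitute `t = 2u`
  set g : ℝ → ℂ := fun t => Complex.cosh (ν / 2 * t) * ((1 / (1 + Real.cosh t) : ℝ) : ℂ) ^ (s / 2)
    with hg
  have hsub := MeasureTheory.integral_comp_mul_left_Ioi g 0 (two_pos : (0 : ℝ) < 2)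
  rw [mul_zero] at hsub
  -- `g (2u) = 2^{-s/2} · cosh(νu) ((cosh u)⁻¹)^s`
  have hpt : ∀ u : ℝ, g (2 * u) =
      (2 : ℂ) ^ (-(s / 2)) * (Complex.cosh (ν * u) * (((Real.cosh u)⁻¹ : ℝ) : ℂ) ^ s) := by
    intro u
    simp only [hg]
    rw [one_div_one_add_cosh_two_mul u, half_mul_inv_sq_cpow (Real.cosh_pos u) (s / 2),
      show (2 : ℂ) * (s / 2) = s by ring]
    have e : ν / 2 * ((2 * u : ℝ) : ℂ) = ν * u := by push_cast; ring
    rw [e]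
    ring
  simp_rw [hpt] at hsub
  rw [MeasureTheory.integral_const_mul] at hsub
  -- `∫ g = 2^{s/2-1} B`, so `2^{-s/2} I = 2⁻¹ 2^{s/2-1} B`
  change (2 : ℂ) ^ (-(s / 2)) * ∫ u in Ioi (0 : ℝ), Complex.cosh (ν * u) * (((Real.cosh u)⁻¹ : ℝ) : ℂ) ^ s =
    (2 : ℝ)⁻¹ • ∫ x in Ioi (0 : ℝ), g x at hsub
  rw [hmom, Complex.real_smul] at hsub
  have h2 : (2 : ℂ) ^ (-(s / 2)) ≠ 0 := Complex.cpow_ne_zero_iff.mpr (Or.inl two_ne_zero)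
  have key : ∫ u in Ioi (0 : ℝ), Complex.cosh (ν * u) * (((Real.cosh u)⁻¹ : ℝ) : ℂ) ^ s =
      ((2 : ℂ) ^ (-(s / 2)))⁻¹ * (((2 : ℝ)⁻¹ : ℝ) : ℂ) *
        ((2 : ℂ) ^ (s / 2 - 1) * Complex.betaIntegral ((s + ν) / 2) ((s - ν) / 2)) := by
    rw [mul_assoc, ← hsub, ← mul_assoc, inv_mul_cancel₀ h2, one_mul]
  rw [key]
  -- powers of two
  have hpow : ((2 : ℂ) ^ (-(s / 2)))⁻¹ * (((2 : ℝ)⁻¹ : ℝ) : ℂ) * (2 : ℂ) ^ (s / 2 - 1) =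
      (2 : ℂ) ^ (s - 2) := by
    rw [← cpow_neg, neg_neg, show (((2 : ℝ)⁻¹ : ℝ) : ℂ) = (2 : ℂ) ^ (-1 : ℂ) by
        rw [cpow_neg_one]; push_cast; ring,
      ← cpow_add _ _ two_ne_zero, ← cpow_add _ _ two_ne_zero]
    congr 1
    ring
  rw [← hpow]
  ring

end CoshMoment

/-! ## 2. The kernel `G(y, t) = y^{s-1} e^{-y cosh t} cosh(νt)` -/

section Kernel

variable {s ν : ℂ}

/- The two-variable kernel is `G(y, t) = y^{s-1} · e^{-y cosh t} cosh(νt) = y^{s-1} · besselKIntegrand ν y t`;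
it is written out in full below (no auxiliary definition, so that the file is theorems-only). -/

/-- Pointwise: `G(y, t) = cosh(νt) · (y^{s-1} e^{-(cosh t) y})`. [folklore] -/
theorem mellinKBesselKernel_eq (s ν : ℂ) (y t : ℝ) :
    (y : ℂ) ^ (s - 1) * besselKIntegrand ν y t =
      Complex.cosh (ν * t) * ((y : ℂ) ^ (s - 1) * Complex.exp (-((Real.cosh t : ℝ) * (y : ℂ)))) := by
  rw [besselKIntegrand]
  have he : Complex.exp (-(y : ℂ) * (Real.cosh t : ℂ)) = Complex.exp (-((Real.cosh t : ℝ) * (y : ℂ))) := by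
    congr 1; ring
  rw [he]
  ring

/-- The norm of the kernel: `‖G(y, t)‖ = y^{Re s - 1} e^{-y cosh t} ‖cosh(νt)‖` (`y > 0`). [folklore] -/
theorem norm_mellinKBesselKernel {y : ℝ} (hy : 0 < y) (t : ℝ) :
    ‖(y : ℂ) ^ (s - 1) * besselKIntegrand ν y t‖ =
      y ^ (s.re - 1) * Real.exp (-(y * Real.cosh t)) * ‖Complex.cosh (ν * t)‖ := by
  rw [besselKIntegrand, norm_mul, norm_mul,
    Complex.norm_cpow_eq_rpow_re_of_pos hy, sub_re, one_re]
  have e2 : ‖Complex.exp (-(y : ℂ) * (Real.cosh t : ℂ))‖ = Real.exp (-(y * Real.cosh t)) := by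
    rw [Complex.norm_exp]
    congr 1
    simp [Complex.mul_re]
  rw [e2]
  ring

/-- **Integrability of the kernel on `(0,∞)²`** for `Re s > |Re ν|`: with `a = Re s`, `b = |Re ν|`,
`a' = (a+b)/2`, the bounds `e^{-y cosh t} = e^{-y cosh t/2} e^{-y cosh t/2} ≤ e^{-y/2} · C (y cosh t/2)^{-a'}`
and `(cosh t)^{-a'} ≤ 2^{a'} e^{-a' t}` split `‖G‖` into the product majorant
`C 4^{a'} · (y^{a-a'-1} e^{-y/2}) · e^{-(a'-b)t}` of two integrable functions. [folklore] -/
theorem integrable_mellinKBesselKernel (h : |ν.re| < s.re) :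
    Integrable (Function.uncurry fun y t : ℝ => (y : ℂ) ^ (s - 1) * besselKIntegrand ν y t)
      ((volume.restrict (Ioi (0 : ℝ))).prod (volume.restrict (Ioi (0 : ℝ)))) := by
  set a : ℝ := s.re with ha_def
  set b : ℝ := |ν.re| with hb_def
  set a' : ℝ := (a + b) / 2 with ha'_def
  have hb0 : 0 ≤ b := abs_nonneg _
  have ha'pos : 0 < a' := by rw [ha'_def]; linarith
  have h1 : 0 < a - a' := by rw [ha'_def]; linarith
  have h2 : 0 < a' - b := by rw [ha'_def]; linarith
  set C : ℝ := a' ^ a' * Real.exp (-a') with hC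
  have hC0 : 0 ≤ C := by positivity
  -- the majorant
  set g : ℝ × ℝ → ℝ := fun p => (C * (4 : ℝ) ^ a') * ((p.1 ^ (a - a' - 1) * Real.exp (-(1 / 2) * p.1)) *
    Real.exp (-(a' - b) * p.2)) with hg
  have hgi : Integrable g ((volume.restrict (Ioi (0 : ℝ))).prod (volume.restrict (Ioi (0 : ℝ)))) := by
    have i1 : Integrable (fun y : ℝ => y ^ (a - a' - 1) * Real.exp (-(1 / 2) * y)) (volume.restrict (Ioi 0)) := by
      have := integrableOn_rpow_mul_exp_neg_mul_rpow (p := 1) (s := a - a' - 1) (b := 1 / 2)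
        (by linarith) le_rfl (by norm_num)
      refine IntegrableOn.congr_fun this (fun y _ => ?_) measurableSet_Ioi
      simp only [Real.rpow_one]
    have i2 : Integrable (fun t : ℝ => Real.exp (-(a' - b) * t)) (volume.restrict (Ioi 0)) :=
      exp_neg_integrableOn_Ioi 0 h2
    exact (i1.mul_prod i2).const_mul _
  -- measurability
  have hmeas : AEStronglyMeasurable (Function.uncurry fun y t : ℝ => (y : ℂ) ^ (s - 1) * besselKIntegrand ν y t)
      ((volume.restrict (Ioi (0 : ℝ))).prod (volume.restrict (Ioi (0 : ℝ)))) := by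
    rw [Measure.prod_restrict]
    refine ContinuousOn.aestronglyMeasurable ?_ (measurableSet_Ioi.prod measurableSet_Ioi)
    intro p hp
    have hp1 : 0 < p.1 := hp.1
    unfold Function.uncurry besselKIntegrand
    refine ContinuousAt.continuousWithinAt ?_
    apply ContinuousAt.mul
    · exact (Complex.continuousAt_ofReal_cpow_const p.1 (s - 1) (Or.inr hp1.ne')).comp continuousAt_fst
    · exact ((Complex.continuous_exp.comp (((Complex.continuous_ofReal.comp continuous_fst).neg).mul
        (Complex.continuous_ofReal.comp (Real.continuous_cosh.comp continuous_snd)))).mul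
        (Complex.continuous_cosh.comp (continuous_const.mul (Complex.continuous_ofReal.comp continuous_snd)))).continuousAt
  refine hgi.mono' hmeas ?_
  rw [Measure.prod_restrict]
  refine (ae_restrict_mem (measurableSet_Ioi.prod measurableSet_Ioi)).mono fun p hp => ?_
  obtain ⟨hy, ht⟩ := hp
  simp only [mem_Ioi] at hy ht
  set y : ℝ := p.1
  set t : ℝ := p.2
  show ‖(y : ℂ) ^ (s - 1) * besselKIntegrand ν y t‖ ≤ g (y, t)
  rw [norm_mellinKBesselKernel hy, hg]
  simp only
  -- the factors
  have f4 : ‖Complex.cosh (ν * t)‖ ≤ Real.exp (b * t) := by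
    refine (norm_cosh_le_cosh_re _).trans ?_
    refine (Literature.Analysis.Complex.DeBruijn1950.cosh_le_exp_abs _).trans ?_
    apply Real.exp_le_exp.mpr
    have : (ν * (t : ℂ)).re = ν.re * t := by simp [Complex.mul_re]
    rw [this, abs_mul, abs_of_pos ht]
  have hct : 1 ≤ Real.cosh t := Real.one_le_cosh t
  have hx : 0 < y * Real.cosh t / 2 := by positivity
  -- `e^{-y cosh t} ≤ e^{-y/2} · e^{-(y cosh t)/2}`
  have f2 : Real.exp (-(y * Real.cosh t)) ≤ Real.exp (-(1 / 2) * y) * Real.exp (-(y * Real.cosh t / 2)) := by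
    rw [← Real.exp_add]
    apply Real.exp_le_exp.mpr
    nlinarith
  -- `e^{-(y cosh t)/2} ≤ C (y cosh t/2)^{-a'} ≤ C 4^{a'} y^{-a'} e^{-a' t}`
  have f3 : Real.exp (-(y * Real.cosh t / 2)) ≤ C * (4 : ℝ) ^ a' * (y ^ (-a') * Real.exp (-a' * t)) := by
    refine (exp_neg_le_mul_rpow_neg ha'pos hx).trans ?_
    rw [← hC]
    have hsplit : (y * Real.cosh t / 2) ^ (-a') = (2 : ℝ) ^ a' * (y ^ (-a') * Real.cosh t ^ (-a')) := by
      rw [show y * Real.cosh t / 2 = (y * Real.cosh t) * (1 / 2) by ring,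
        Real.mul_rpow (by positivity) (by norm_num), Real.mul_rpow hy.le (Real.cosh_pos t).le,
        Real.div_rpow zero_le_one zero_le_two, Real.one_rpow, Real.rpow_neg zero_le_two]
      field_simp
    rw [hsplit]
    have hcosh := cosh_rpow_neg_le ha'pos.le t
    have hy' : 0 ≤ y ^ (-a') := Real.rpow_nonneg hy.le _
    have h4 : (4 : ℝ) ^ a' = (2 : ℝ) ^ a' * (2 : ℝ) ^ a' := by
      rw [← Real.mul_rpow zero_le_two zero_le_two]; norm_num
    calc C * ((2 : ℝ) ^ a' * (y ^ (-a') * Real.cosh t ^ (-a')))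
        ≤ C * ((2 : ℝ) ^ a' * (y ^ (-a') * ((2 : ℝ) ^ a' * Real.exp (-a' * t)))) := by gcongr
      _ = C * (4 : ℝ) ^ a' * (y ^ (-a') * Real.exp (-a' * t)) := by rw [h4]; ring
  have hya : y ^ (a - 1) * y ^ (-a') = y ^ (a - a' - 1) := by
    rw [← Real.rpow_add hy]; ring_nf
  have hexp0 : 0 ≤ Real.exp (-(1 / 2) * y) := (Real.exp_pos _).le
  calc y ^ (a - 1) * Real.exp (-(y * Real.cosh t)) * ‖Complex.cosh (ν * t)‖
      ≤ y ^ (a - 1) * (Real.exp (-(1 / 2) * y) * (C * (4 : ℝ) ^ a' * (y ^ (-a') * Real.exp (-a' * t)))) *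
          Real.exp (b * t) := by
        gcongr
        exact f2.trans (mul_le_mul_of_nonneg_left f3 hexp0)
    _ = (C * (4 : ℝ) ^ a') * ((y ^ (a - 1) * y ^ (-a')) * Real.exp (-(1 / 2) * y)) *
          (Real.exp (-a' * t) * Real.exp (b * t)) := by ring
    _ = (C * (4 : ℝ) ^ a') * ((y ^ (a - a' - 1) * Real.exp (-(1 / 2) * y)) * Real.exp (-(a' - b) * t)) := by
        rw [hya, ← Real.exp_add]; ring_nf

/-- The inner integral: `∫₀^∞ G(y, t) dy = cosh(νt) ((cosh t)⁻¹)^s Γ(s)` (`Re s > 0`). [folklore] -/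
theorem integral_mellinKBesselKernel_left (hs : 0 < s.re) (t : ℝ) :
    ∫ y in Ioi (0 : ℝ), (y : ℂ) ^ (s - 1) * besselKIntegrand ν y t =
      Complex.cosh (ν * t) * ((((Real.cosh t)⁻¹ : ℝ) : ℂ) ^ s * Complex.Gamma s) := by
  have hr : 0 < Real.cosh t := Real.cosh_pos t
  simp_rw [mellinKBesselKernel_eq]
  rw [MeasureTheory.integral_const_mul, Complex.integral_cpow_mul_exp_neg_mul_Ioi hs hr]
  congr 3
  push_cast
  ring

end Kernel

/-! ## 3. The Mellin transform of `K_ν` -/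

section Mellin

variable {s ν : ℂ}

/-- **The Mellin transform of the Macdonald function** (Watson §13.21 (8); DLMF 10.43.19; Goldfeld
(2006), proof of Prop. 3.13.5: "the well-known transform"). For `Re s > |Re ν|`,
`∫₀^∞ y^{s-1} K_ν(y) dy = 2^{s-2} Γ((s+ν)/2) Γ((s-ν)/2)`
(insert `K_ν(y) = ∫₀^∞ e^{-y cosh t} cosh(νt) dt`, integrate in `y` first, evaluate the
`cosh`-moment of `(cosh t)^{-s}` and use `Γ(u)Γ(v) = Γ(u+v)B(u,v)` with `u + v = s`).
[cite: Goldfeld2006, proof of Prop. 3.13.5, PDF p. 74] [cite: Watson1944, §13.21 (8)] -/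
theorem integral_cpow_mul_besselK (h : |ν.re| < s.re) :
    ∫ y in Ioi (0 : ℝ), (y : ℂ) ^ (s - 1) * besselK ν y =
      (2 : ℂ) ^ (s - 2) * Complex.Gamma ((s + ν) / 2) * Complex.Gamma ((s - ν) / 2) := by
  have hs : 0 < s.re := lt_of_le_of_lt (abs_nonneg _) h
  have hu : 0 < ((s + ν) / 2).re := by
    rw [div_ofNat_re, add_re]; have := neg_abs_le ν.re; linarith
  have hv : 0 < ((s - ν) / 2).re := by
    rw [div_ofNat_re, sub_re]; have := le_abs_self ν.re; linarith
  -- Step 1: the integrand as an inner integral of the kernel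
  have step1 : ∫ y in Ioi (0 : ℝ), (y : ℂ) ^ (s - 1) * besselK ν y =
      ∫ y in Ioi (0 : ℝ), ∫ t in Ioi (0 : ℝ), (y : ℂ) ^ (s - 1) * besselKIntegrand ν y t := by
    refine setIntegral_congr_fun measurableSet_Ioi fun y _ => ?_
    rw [besselK_def, ← MeasureTheory.integral_const_mul]
    rfl
  -- Step 2: Fubini
  have step2 : (∫ y in Ioi (0 : ℝ), ∫ t in Ioi (0 : ℝ), (y : ℂ) ^ (s - 1) * besselKIntegrand ν y t) =
      ∫ t in Ioi (0 : ℝ), ∫ y in Ioi (0 : ℝ), (y : ℂ) ^ (s - 1) * besselKIntegrand ν y t :=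
    integral_integral_swap (integrable_mellinKBesselKernel h)
  -- Step 3: the inner integral and the cosh-moment
  have step3 : (∫ t in Ioi (0 : ℝ), ∫ y in Ioi (0 : ℝ), (y : ℂ) ^ (s - 1) * besselKIntegrand ν y t) =
      Complex.Gamma s * ((2 : ℂ) ^ (s - 2) * Complex.betaIntegral ((s + ν) / 2) ((s - ν) / 2)) := by
    simp_rw [integral_mellinKBesselKernel_left hs]
    rw [← integral_cosh_mul_inv_cosh_cpow h, ← MeasureTheory.integral_const_mul]
    exact integral_congr_ae (Eventually.of_forall fun t => by ring)
  rw [step1, step2, step3]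
  -- Step 4: Gamma-function algebra
  have hB := Complex.Gamma_mul_Gamma_eq_betaIntegral hu hv
  rw [show (s + ν) / 2 + (s - ν) / 2 = s by ring] at hB
  rw [mul_assoc ((2 : ℂ) ^ (s - 2)), hB]
  ring

/-- **Absolute convergence of the Mellin transform of `K_ν`**: for `Re s > |Re ν|`,
`y ↦ y^{s-1} K_ν(y)` is integrable on `(0, ∞)`. [cite: Watson1944, §13.21 (8)] -/
theorem integrableOn_cpow_mul_besselK (h : |ν.re| < s.re) :
    IntegrableOn (fun y : ℝ => (y : ℂ) ^ (s - 1) * besselK ν y) (Ioi 0) := by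
  have hI := (integrable_mellinKBesselKernel h).integral_prod_left
  refine IntegrableOn.congr_fun (f := fun y : ℝ => ∫ t in Ioi (0 : ℝ), (y : ℂ) ^ (s - 1) * besselKIntegrand ν y t)
    hI (fun y _ => ?_) measurableSet_Ioi
  simp only
  rw [besselK_def, ← MeasureTheory.integral_const_mul]
  rfl

end Mellin

/-! ## 4. Scalings: `K_ν(cy)` and the archimedean `GL(2)` factor `¼ Γ_ℝ(s+ν) Γ_ℝ(s-ν)` -/

section Scaling

variable {s ν : ℂ}

/-- For `c > 0` and `y > 0`: `(cy)^{s-1} = c^{s-1} y^{s-1}` (real positive bases). [folklore] -/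
theorem ofReal_mul_cpow_sub_one {c y : ℝ} (hc : 0 < c) (hy : 0 < y) (s : ℂ) :
    (((c * y : ℝ)) : ℂ) ^ (s - 1) = (c : ℂ) ^ (s - 1) * (y : ℂ) ^ (s - 1) := by
  push_cast
  exact mul_cpow_ofReal_nonneg hc.le hy.le _

/-- **The Mellin transform of `K_ν(cy)`**: for `c > 0` and `Re s > |Re ν|`,
`∫₀^∞ y^{s-1} K_ν(cy) dy = c^{-s} · 2^{s-2} Γ((s+ν)/2) Γ((s-ν)/2)` (substitute `y ↦ y/c`).
[cite: Watson1944, §13.21 (8)] [cite: Goldfeld2006, proof of Prop. 3.13.5, (3.13.6), PDF p. 74] -/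
theorem integral_cpow_mul_besselK_mul {c : ℝ} (hc : 0 < c) (h : |ν.re| < s.re) :
    ∫ y in Ioi (0 : ℝ), (y : ℂ) ^ (s - 1) * besselK ν ((c * y : ℝ) : ℂ) =
      (c : ℂ) ^ (-s) * ((2 : ℂ) ^ (s - 2) * Complex.Gamma ((s + ν) / 2) * Complex.Gamma ((s - ν) / 2)) := by
  have hc0 : (c : ℂ) ≠ 0 := ofReal_ne_zero.mpr hc.ne'
  -- `∫ y^{s-1} K(cy) = c^{1-s} ∫ (cy)^{s-1} K(cy) = c^{1-s} c⁻¹ ∫ u^{s-1} K(u)`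
  set G : ℝ → ℂ := fun u => (u : ℂ) ^ (s - 1) * besselK ν u with hG
  have hsub := MeasureTheory.integral_comp_mul_left_Ioi G 0 hc
  rw [mul_zero] at hsub
  have hpt : ∀ y ∈ Ioi (0 : ℝ), (y : ℂ) ^ (s - 1) * besselK ν ((c * y : ℝ) : ℂ) =
      (c : ℂ) ^ (1 - s) * G (c * y) := by
    intro y hy
    simp only [hG]
    rw [ofReal_mul_cpow_sub_one hc hy s, ← mul_assoc, ← mul_assoc, ← cpow_add _ _ hc0,
      show 1 - s + (s - 1) = (0 : ℂ) by ring, cpow_zero, one_mul]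
  rw [setIntegral_congr_fun measurableSet_Ioi hpt, MeasureTheory.integral_const_mul, hsub,
    Complex.real_smul, integral_cpow_mul_besselK h]
  have e : (c : ℂ) ^ (1 - s) * ((c⁻¹ : ℝ) : ℂ) = (c : ℂ) ^ (-s) := by
    rw [show ((c⁻¹ : ℝ) : ℂ) = (c : ℂ) ^ (-1 : ℂ) by rw [cpow_neg_one]; push_cast; ring,
      ← cpow_add _ _ hc0]
    congr 1; ring
  rw [← mul_assoc, e]

/-- Integrability of `y ↦ y^{s-1} K_ν(cy)` on `(0,∞)` for `c > 0`, `Re s > |Re ν|`. [folklore] -/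
theorem integrableOn_cpow_mul_besselK_mul {c : ℝ} (hc : 0 < c) (h : |ν.re| < s.re) :
    IntegrableOn (fun y : ℝ => (y : ℂ) ^ (s - 1) * besselK ν ((c * y : ℝ) : ℂ)) (Ioi 0) := by
  have hc0 : (c : ℂ) ≠ 0 := ofReal_ne_zero.mpr hc.ne'
  set G : ℝ → ℂ := fun u => (u : ℂ) ^ (s - 1) * besselK ν u with hG
  have hGi : IntegrableOn G (Ioi 0) := integrableOn_cpow_mul_besselK h
  have hGc : IntegrableOn (fun y => G (c * y)) (Ioi 0) := by
    have := (MeasureTheory.integrableOn_Ioi_comp_mul_left_iff G 0 hc).mpr (by rwa [mul_zero])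
    exact this
  refine IntegrableOn.congr_fun (hGc.const_mul ((c : ℂ) ^ (1 - s))) (fun y hy => ?_) measurableSet_Ioi
  simp only [hG]
  rw [ofReal_mul_cpow_sub_one hc hy s, ← mul_assoc, ← mul_assoc, ← cpow_add _ _ hc0,
    show 1 - s + (s - 1) = (0 : ℂ) by ring, cpow_zero, one_mul]

/-- `π^{-s} Γ((s+ν)/2) Γ((s-ν)/2) = Γ_ℝ(s+ν) Γ_ℝ(s-ν)` (Mathlib's `Gammaℝ s = π^{-s/2} Γ(s/2)`). [folklore] -/
theorem Gammaℝ_add_mul_Gammaℝ_sub (s ν : ℂ) :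
    Complex.Gammaℝ (s + ν) * Complex.Gammaℝ (s - ν) =
      (π : ℂ) ^ (-s) * (Complex.Gamma ((s + ν) / 2) * Complex.Gamma ((s - ν) / 2)) := by
  rw [Complex.Gammaℝ_def, Complex.Gammaℝ_def]
  have hπ : (π : ℂ) ≠ 0 := ofReal_ne_zero.mpr Real.pi_pos.ne'
  have e : (π : ℂ) ^ (-(s + ν) / 2) * (π : ℂ) ^ (-(s - ν) / 2) = (π : ℂ) ^ (-s) := by
    rw [← cpow_add _ _ hπ]; congr 1; ring
  calc (π : ℂ) ^ (-(s + ν) / 2) * Complex.Gamma ((s + ν) / 2) *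
        ((π : ℂ) ^ (-(s - ν) / 2) * Complex.Gamma ((s - ν) / 2))
      = ((π : ℂ) ^ (-(s + ν) / 2) * (π : ℂ) ^ (-(s - ν) / 2)) *
          (Complex.Gamma ((s + ν) / 2) * Complex.Gamma ((s - ν) / 2)) := by ring
    _ = _ := by rw [e]

/-- **The archimedean Euler factor of the even principal series of `GL₂(ℝ)` as a Mellin transform**:
for `Re s > |Re ν|`,
`∫₀^∞ K_ν(2πy) y^{s-1} dy = ¼ π^{-s} Γ((s+ν)/2) Γ((s-ν)/2) = ¼ Γ_ℝ(s+ν) Γ_ℝ(s-ν)` —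
the integral `∫₀^∞ W(diag(y,1)) y^{s-1/2} d^×y` for the weight-zero Whittaker function
`W(diag(y,1)) = √y K_ν(2πy)` (Goldfeld (2006), (3.13.6); Bump (1997), §1.9; Jacquet–Langlands (1970),
Thm. 5.15: `L(s, π(μ₁, μ₂)) = Γ_ℝ(s+ν)Γ_ℝ(s-ν)` for `μᵢ = |·|^{±ν}`).
[cite: Goldfeld2006, Prop. 3.13.5 and (3.13.6), PDF p. 74] [cite: JacquetLanglands1970, Thm. 5.15] -/
theorem integral_besselK_two_pi_mul_cpow (h : |ν.re| < s.re) :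
    ∫ y in Ioi (0 : ℝ), (y : ℂ) ^ (s - 1) * besselK ν ((2 * π * y : ℝ) : ℂ) =
      (1 / 4 : ℂ) * (Complex.Gammaℝ (s + ν) * Complex.Gammaℝ (s - ν)) := by
  have h2π : 0 < 2 * π := by positivity
  rw [integral_cpow_mul_besselK_mul h2π h, Gammaℝ_add_mul_Gammaℝ_sub]
  have hπ : (π : ℂ) ≠ 0 := ofReal_ne_zero.mpr Real.pi_pos.ne'
  -- `(2π)^{-s} 2^{s-2} = ¼ π^{-s}`
  have e1 : (((2 * π : ℝ)) : ℂ) ^ (-s) = (2 : ℂ) ^ (-s) * (π : ℂ) ^ (-s) := by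
    push_cast
    exact mul_cpow_ofReal_nonneg zero_le_two Real.pi_pos.le _
  have e2 : (2 : ℂ) ^ (-s) * (2 : ℂ) ^ (s - 2) = 1 / 4 := by
    rw [← cpow_add _ _ two_ne_zero, show -s + (s - 2) = (-2 : ℂ) by ring, cpow_neg,
      show (2 : ℂ) ^ (2 : ℂ) = 4 by rw [cpow_two]; norm_num]
    norm_num
  rw [e1]
  calc (2 : ℂ) ^ (-s) * (π : ℂ) ^ (-s) *
        ((2 : ℂ) ^ (s - 2) * Complex.Gamma ((s + ν) / 2) * Complex.Gamma ((s - ν) / 2))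
      = ((2 : ℂ) ^ (-s) * (2 : ℂ) ^ (s - 2)) *
          ((π : ℂ) ^ (-s) * (Complex.Gamma ((s + ν) / 2) * Complex.Gamma ((s - ν) / 2))) := by ring
    _ = _ := by rw [e2]

/-- The same in the variable of the torus integral `∫₀^∞ (√y K_ν(2πy)) y^{s - 1/2} dy/y`: for
`Re s > |Re ν|`, `∫₀^∞ (y^{1/2} K_ν(2πy)) y^{s - 1/2 - 1} dy = ¼ Γ_ℝ(s+ν) Γ_ℝ(s-ν)`.
[cite: Goldfeld2006, (3.13.6), PDF p. 74] [cite: JacquetLanglands1970, Thm. 5.15] -/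
theorem integral_sqrt_mul_besselK_two_pi_mul_cpow (h : |ν.re| < s.re) :
    ∫ y in Ioi (0 : ℝ), ((y : ℂ) ^ (1 / 2 : ℂ) * besselK ν ((2 * π * y : ℝ) : ℂ)) * (y : ℂ) ^ (s - 1 / 2 - 1) =
      (1 / 4 : ℂ) * (Complex.Gammaℝ (s + ν) * Complex.Gammaℝ (s - ν)) := by
  rw [← integral_besselK_two_pi_mul_cpow h]
  refine setIntegral_congr_fun measurableSet_Ioi fun y hy => ?_
  have hy0 : (y : ℂ) ≠ 0 := ofReal_ne_zero.mpr (ne_of_gt hy)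
  have e : (y : ℂ) ^ (1 / 2 : ℂ) * (y : ℂ) ^ (s - 1 / 2 - 1) = (y : ℂ) ^ (s - 1) := by
    rw [← cpow_add _ _ hy0]; congr 1; ring
  calc (y : ℂ) ^ (1 / 2 : ℂ) * besselK ν ((2 * π * y : ℝ) : ℂ) * (y : ℂ) ^ (s - 1 / 2 - 1)
      = ((y : ℂ) ^ (1 / 2 : ℂ) * (y : ℂ) ^ (s - 1 / 2 - 1)) * besselK ν ((2 * π * y : ℝ) : ℂ) := by ring
    _ = _ := by rw [e]

end Scaling

end Literature.Analysis.FunctionSpaces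

end
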